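import Literature.NumberTheory.Automorphic.Sweep1PotentialModularityFrobeniusProofs
import Literature.NumberTheory.EllipticCurves.HasseWeilGoodReductionFrobeniusProofs
import Literature.NumberTheory.EllipticCurves.IsogenyDeterminantProofs
import Literature.NumberTheory.EllipticCurves.FrobeniusTateModuleTraceProofs
import HarnessLib

/-!
# lang.S28 (`Sweep1` form) from the source, the Weil pairing and elliptic curves over finite fields

`Proofs` companion (theorems only) of `Literature.NumberTheory.Automorphic.Sweep1` for the named
fact `Literature.NumberTheory.Automorphic.exists_isCMField_isModular` (**lang.S28**: an elliptic curve without geometric CM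
over a CM field becomes modular over a finite CM extension; Allen–Calegari–Caraiani–Gee–Helm–
Le Hung–Newton–Scholze–Taylor–Thorne, *Potential automorphy over CM fields*, Ann. of Math. 197
(2023), Thm. 1.0.1), continuing `Sweep1PotentialModularity(…Proofs)`,
`Sweep1PotentialModularityGoodReductionProofs` and `Sweep1PotentialModularityFrobeniusProofs`
(same tenured seat).  The last of these recorded `exists_isCMField_isModular_of_facts`: lang.S28
from the source in Galois form (ACC+ Cor. 7.1.12 for `R_E`: over a finite Galois CM extension
`F'/F`, `E ×_F F'` is Tate-automorphic — throughout this file the explicit hypothesis `hACC`, the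
statement of the former named fact `exists_isCMField_isTateAutomorphic`, merged back into the
obligation `exists_isCMField_isModular` by the review of 2026-08-15, D-0026), the Weil
pairings, the Frobenius-equivariant reduction isomorphisms `T_ℓ E ≅ T_ℓ Ẽ_v` at the good places
(`WeierstrassCurve.galoisRepTate_frobenius_conj_reductionAt`) and the trace of Frobenius on the
Tate module of an elliptic curve over a finite field (Silverman V.2.3.1).  The reduction
isomorphism is now **proved** (`WeierstrassCurve.galoisRepTate_frobenius_conj_reductionAt_holds`,
file `EllipticCurves/HasseWeilGoodReductionFrobeniusProofs`: Silverman VII.2.1/VII.3.1(b)/VII.4.1,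
Diamond–Shurman Thm. 9.4.1), and this file records the shortened dependency statements:

* `exists_isCMField_isModular_of_weilPairing_of_finiteField`: lang.S28 from the source, the Weil
  pairings on `E[ℓⁿ]` for elliptic curves over number fields (Silverman Prop. III.8.1) and the
  trace of the `q`-Frobenius on `T_ℓ` of elliptic curves over (finite) fields (Thm. V.2.3.1);
* `exists_isCMField_isModular_of_weilPairing_of_deg`: lang.S28 from the source, the Weil pairings
  (on elliptic curves over number fields and over their residue fields), Silverman Prop. III.8.6
  (`det T_ℓ(ψ) = deg ψ`) and Thm. III.4.10(a) (`#ker ψ = deg_s ψ`) for isogenies of elliptic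
  curves over the residue fields — V.2.3.1 being reduced to these in `FrobeniusTateModuleProofs`
  (with Cor. III.5.5 proved in `FrobeniusSeparableProofs`).

## Part 2 (appended). The Weil pairing and III.4.10(a) are proved: lang.S28 from the source and Cor. III.6.3

Since Part 1 the tree proved the Weil pairing (`WeierstrassCurve.exists_weilPairing_holds`,
`EllipticCurves/WeilPairingProofs`, Silverman Prop. III.8.1), Thm. III.4.10(a)
(`Isogeny.card_ker_eq_finSepDegree_holds`, `IsogenyDegreeKernelProofs`), Cor. III.5.5 and
Prop. II.2.11(c), and reduced Prop. III.8.6 (`Isogeny.det_tateModule_map_eq_deg`) to Cor. III.6.3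
(`degHom_isQuadraticForm`: `deg` is a quadratic form on `End_K(E)`;
`Isogeny.det_tateModule_map_eq_deg_of_isQuadraticForm`, `IsogenyDeterminantProofs`).  Feeding
these in:

* `exists_isCMField_isModular_of_det_tateModule_map_eq_deg`: lang.S28 from the source and
  Prop. III.8.6 (`det T_ℓ(ψ) = deg ψ` for endomorphisms of elliptic curves over the residue
  fields) alone;
* `exists_isCMField_isModular_of_isQuadraticForm`: lang.S28 from the source and Cor. III.6.3
  (`deg` is a quadratic form on `End_k(Ẽ)` for elliptic curves over the residue fields) alone.

So `Literature.NumberTheory.Automorphic.exists_isCMField_isModular` now rests on the source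
(ACC+GHLNSTT 2023, Cor. 7.1.12 for `R_E`, the Galois-side hypothesis) and exactly one named fact of
the tree, `WeierstrassCurve.degHom_isQuadraticForm` (Silverman Cor. III.6.3).

## Part 3 (appended). V.2.3.1 is proved: lang.S28 from the source alone

The tree now proves Thm. V.2.3.1 (`WeierstrassCurve.trace_galoisRepTate_frobenius_holds`,
`FrobeniusTateModuleTraceProofs`, through Manin's relation `φ² - aφ + q = 0`; independently also
Cor. III.6.3 and Prop. III.8.6, `IsogenyDegreeQuadraticFormProofs`). So:

* `WeierstrassCurve.isModular_of_isTateAutomorphic`: every Tate-automorphic elliptic curve over a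
  number field is modular in the `Sweep1` sense — no hypotheses left on the elliptic-curve side;
* `exists_isCMField_isModular_of_exists_isCMField_isTateAutomorphic`:
  **Galois form → `exists_isCMField_isModular`** — the named fact of `Sweep1` (lang.S28) follows
  from the Galois-side transcription of the source theorem alone (the transcription being the
  explicit hypothesis; it was the named fact `exists_isCMField_isTateAutomorphic` until the review
  of 2026-08-15 merged it back into this obligation).

## References

* [AllenCalegariCaraianiGeeEtAl2023] P. B. Allen, F. Calegari, A. Caraiani, T. Gee, D. Helm,
  B. V. Le Hung, J. Newton, P. Scholze, R. Taylor, J. A. Thorne, *Potential automorphy over CM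
  fields*, Ann. of Math. (2) 197 (2023), 897–1113: Thm. 1.0.1, §7.1, Cor. 7.1.12.
* [SilvermanAEC2009] J. H. Silverman, *The Arithmetic of Elliptic Curves*, 2nd ed., GTM 106
  (2009): Cor. III.6.3, Prop. III.8.1, Prop. III.8.6, Thm. III.4.10(a), Thm. V.2.3.1, Prop. VII.2.1,
  Prop. VII.3.1(b), Prop. VII.4.1, C.§16, C.21 Remark 21.3.
* [DiamondShurman2005] F. Diamond, J. Shurman, *A First Course in Modular Forms* (2005),
  Thm. 9.4.1.

## Design

No definitions; universe-`0` number fields (`{K : Type}`) as in `Sweep1`; hypotheses are named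
facts quantified over all curves over all (number, resp. arbitrary) fields, the form in which a
discharge `theorem X_holds : X` is consumed.
-/

noncomputable section

namespace Literature.NumberTheory.Automorphic

open WeierstrassCurve

/-- **lang.S28 from the source, the Weil pairing and V.2.3.1.**  The Galois-side statement of the
source (ACC+GHLNSTT 2023, Thm. 1.0.1 non-CM case via Cor. 7.1.12; hypothesis `hACC`),
the Weil pairings on `E[ℓ^{n+1}]` for elliptic curves over number fields (`exists_weilPairing`,
Silverman Prop. III.8.1) and the trace of Frobenius on the Tate module of elliptic curves over
finite fields (`trace_galoisRepTate_frobenius`, Silverman Thm. V.2.3.1) imply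
`Literature.NumberTheory.Automorphic.exists_isCMField_isModular` — the reduction isomorphism hypothesis of
`exists_isCMField_isModular_of_facts` being discharged by
`galoisRepTate_frobenius_conj_reductionAt_holds`.
[cite: AllenCalegariCaraianiGeeEtAl2023, Thm. 1.0.1 (non-CM case), via Cor. 7.1.12]
[cite: SilvermanAEC2009, Prop. III.8.1, Thm. V.2.3.1, Prop. VII.4.1 and C.21 Remark 21.3] -/
theorem exists_isCMField_isModular_of_weilPairing_of_finiteField (ℓ : ℕ) [Fact ℓ.Prime]
    (hACC : ∀ {F : Type} [Field F] [NumberField F] [NumberField.IsCMField F]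
      (W : WeierstrassCurve F) [W.IsElliptic] (_hW : ¬ W.HasCM),
      ∃ (F' : Type) (_ : Field F') (_ : NumberField F') (_ : Algebra F F'),
        NumberField.IsCMField F' ∧ IsGalois F F' ∧ (W.baseChange F').IsTateAutomorphic)
    (hW : ∀ {K : Type} [Field K] [NumberField K] (W : WeierstrassCurve K) (n : ℕ),
      W.exists_weilPairing (ℓ ^ (n + 1)))
    (htr : ∀ {k : Type} [Field k] (C : WeierstrassCurve k), C.trace_galoisRepTate_frobenius ℓ) :
    exists_isCMField_isModular :=
  exists_isCMField_isModular_of_facts ℓ hACC hW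
    (fun W ↦ galoisRepTate_frobenius_conj_reductionAt_holds (W := W)) htr

/-- **lang.S28 from the source, the Weil pairings, III.8.6 and III.4.10(a).**  The Galois-side
statement of the source (hypothesis `hACC`), the Weil pairings on `E[ℓ^{n+1}]` for
elliptic curves over all fields of characteristic `≠ ℓ` in play (number fields and their residue
fields; `exists_weilPairing`, Silverman Prop. III.8.1), and, for isogenies of elliptic curves
over the residue fields, `det T_ℓ(ψ) = deg ψ` (`Isogeny.det_tateModule_map_eq_deg`, Prop. III.8.6)
and `#ker ψ = deg_s ψ` (`Isogeny.card_ker_eq_finSepDegree`, Thm. III.4.10(a)) imply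
`Literature.NumberTheory.Automorphic.exists_isCMField_isModular`
(`hasseWeilEulerFactor_of_hasGoodReduction_of_weilPairing_of_deg`).
[cite: AllenCalegariCaraianiGeeEtAl2023, Thm. 1.0.1 (non-CM case), via Cor. 7.1.12]
[cite: SilvermanAEC2009, Prop. III.8.1, Prop. III.8.6, Thm. III.4.10(a), Thm. V.2.3.1, C.§16] -/
theorem exists_isCMField_isModular_of_weilPairing_of_deg (ℓ : ℕ) [Fact ℓ.Prime]
    (hACC : ∀ {F : Type} [Field F] [NumberField F] [NumberField.IsCMField F]
      (W : WeierstrassCurve F) [W.IsElliptic] (_hW : ¬ W.HasCM),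
      ∃ (F' : Type) (_ : Field F') (_ : NumberField F') (_ : Algebra F F'),
        NumberField.IsCMField F' ∧ IsGalois F F' ∧ (W.baseChange F').IsTateAutomorphic)
    (hW : ∀ {K : Type} [Field K] (W : WeierstrassCurve K) (n : ℕ),
      W.exists_weilPairing (ℓ ^ (n + 1)))
    (h86 : ∀ {k : Type} [Field k] (C : WeierstrassCurve k), Isogeny.det_tateModule_map_eq_deg C ℓ)
    (h410 : ∀ {k : Type} [Field k] (C : WeierstrassCurve k), Isogeny.card_ker_eq_finSepDegree C C) :
    exists_isCMField_isModular :=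
  exists_isCMField_isModular_of_isTateAutomorphic_of_hasGoodReduction ℓ hACC fun W ↦
    hasseWeilEulerFactor_of_hasGoodReduction_of_weilPairing_of_deg (W := W) ℓ (hW W)
      (fun _ n ↦ hW _ n) (fun _ ↦ h86 _) (fun _ ↦ h410 _)

/-! ## Part 2: the Weil pairing and III.4.10(a) proved — lang.S28 from the source and III.8.6, resp. Cor. III.6.3 -/

/-- **lang.S28 from the source and Silverman Prop. III.8.6.**  The Galois-side statement of the
source (ACC+GHLNSTT 2023, Thm. 1.0.1 non-CM case via Cor. 7.1.12; hypothesis `hACC`) and, for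
endomorphisms `ψ` of elliptic curves over fields `k` and primes
`ℓ ≠ char k`, `det T_ℓ(ψ) = deg ψ` (`Isogeny.det_tateModule_map_eq_deg`, Silverman Prop. III.8.6)
imply `Literature.NumberTheory.Automorphic.exists_isCMField_isModular`: `exists_isCMField_isModular_of_weilPairing_of_deg`
with the Weil pairings (`exists_weilPairing_holds`, Prop. III.8.1) and `#ker ψ = deg_s ψ`
(`Isogeny.card_ker_eq_finSepDegree_holds`, Thm. III.4.10(a)) now theorems of the tree.
[cite: AllenCalegariCaraianiGeeEtAl2023, Thm. 1.0.1 (non-CM case), via Cor. 7.1.12]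
[cite: SilvermanAEC2009, Prop. III.8.6, Thm. V.2.3.1, Prop. VII.4.1 and C.21 Remark 21.3] -/
theorem exists_isCMField_isModular_of_det_tateModule_map_eq_deg (ℓ : ℕ) [Fact ℓ.Prime]
    (hACC : ∀ {F : Type} [Field F] [NumberField F] [NumberField.IsCMField F]
      (W : WeierstrassCurve F) [W.IsElliptic] (_hW : ¬ W.HasCM),
      ∃ (F' : Type) (_ : Field F') (_ : NumberField F') (_ : Algebra F F'),
        NumberField.IsCMField F' ∧ IsGalois F F' ∧ (W.baseChange F').IsTateAutomorphic)
    (h86 : ∀ {k : Type} [Field k] (C : WeierstrassCurve k), Isogeny.det_tateModule_map_eq_deg C ℓ) :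
    exists_isCMField_isModular :=
  exists_isCMField_isModular_of_weilPairing_of_deg ℓ hACC (fun W _ ↦ W.exists_weilPairing_holds _)
    h86 fun C ↦ Isogeny.card_ker_eq_finSepDegree_holds C C

/-- **lang.S28 from the source and Silverman Cor. III.6.3.**  The Galois-side statement of the
source (hypothesis `hACC`) and, for elliptic curves `C` over fields `k`,
"`deg` is a quadratic form on `End_k(C)`" (`degHom_isQuadraticForm C C`, Silverman Cor. III.6.3)
imply `Literature.NumberTheory.Automorphic.exists_isCMField_isModular` — Prop. III.8.6 being reduced to Cor. III.6.3 in the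
tree (`Isogeny.det_tateModule_map_eq_deg_of_isQuadraticForm`, `IsogenyDeterminantProofs`).  With
this, lang.S28 in the `Sweep1` form rests on the source and exactly one named fact,
`degHom_isQuadraticForm`.
[cite: AllenCalegariCaraianiGeeEtAl2023, Thm. 1.0.1 (non-CM case), via Cor. 7.1.12]
[cite: SilvermanAEC2009, Cor. III.6.3, Prop. III.8.6, Thm. V.2.3.1, Prop. VII.4.1 and C.21 Remark 21.3] -/
theorem exists_isCMField_isModular_of_isQuadraticForm (ℓ : ℕ) [Fact ℓ.Prime]
    (hACC : ∀ {F : Type} [Field F] [NumberField F] [NumberField.IsCMField F]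
      (W : WeierstrassCurve F) [W.IsElliptic] (_hW : ¬ W.HasCM),
      ∃ (F' : Type) (_ : Field F') (_ : NumberField F') (_ : Algebra F F'),
        NumberField.IsCMField F' ∧ IsGalois F F' ∧ (W.baseChange F').IsTateAutomorphic)
    (h63 : ∀ {k : Type} [Field k] (C : WeierstrassCurve k), degHom_isQuadraticForm C C) :
    exists_isCMField_isModular :=
  exists_isCMField_isModular_of_det_tateModule_map_eq_deg ℓ hACC fun C ↦
    Isogeny.det_tateModule_map_eq_deg_of_isQuadraticForm (h63 C)

/-! ## Part 3: V.2.3.1 proved — lang.S28 (`Sweep1` form) from the source alone -/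

/-- **A Tate-automorphic elliptic curve over a number field is modular in the `Sweep1` sense,
unconditionally.**  If the compatible system `(V_ℓ E)_ℓ` of an elliptic curve `E` over a number
field `F` is automorphic in the sense of `WeierstrassCurve.IsTateAutomorphic` (ACC+GHLNSTT §7.1,
read in the tree's `L²`/Satake language), then `E` is modular (`WeierstrassCurve.IsModular` of
`Sweep1`: the local polynomials of `E` are the Satake Euler factors of a cuspidal automorphic
representation of `GL₂(𝔸_F)` at almost all places).  This is `IsTateAutomorphic.isModular` of
`Sweep1PotentialModularity` with every elliptic-curve input now a theorem of the tree: at `ℓ = 2`,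
`IsTateAutomorphic.isModular_of_hasGoodReduction` fed with
`hasseWeilEulerFactor_of_hasGoodReduction_of_weilPairing_of_finiteField` and the discharges
`exists_weilPairing_holds` (Silverman Prop. III.8.1, `WeilPairingProofs`) and
`trace_galoisRepTate_frobenius_holds` (Thm. V.2.3.1, `FrobeniusTateModuleTraceProofs`).
[cite: SilvermanAEC2009, C.§16 and C.21 Remark 21.3, Thm. V.2.3.1, Prop. VII.4.1] -/
theorem _root_.WeierstrassCurve.isModular_of_isTateAutomorphic {F : Type} [Field F] [NumberField F]
    {W : WeierstrassCurve F} [W.IsElliptic] (hW : W.IsTateAutomorphic) : W.IsModular :=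
  hW.isModular_of_hasGoodReduction 2
    (hasseWeilEulerFactor_of_hasGoodReduction_of_weilPairing_of_finiteField (W := W) 2
      (fun _ ↦ W.exists_weilPairing_holds _) fun v ↦
        (W.reductionAt v).trace_galoisRepTate_frobenius_holds 2)

/-- **lang.S28 in the `Sweep1` form from lang.S28 in the Galois form (the source) alone.**  The
Galois-side statement of Allen–Calegari–Caraiani–Gee–Helm–Le Hung–Newton–Scholze–Taylor–Thorne,
*Potential automorphy over CM fields*, Ann. of Math. 197 (2023), Thm. 1.0.1 for a non-CM `E`
through Cor. 7.1.12 (`m = 1`) for the compatible system `R_E` — *for every elliptic curve `E`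
without geometric CM over a CM number field `F` there is a finite extension `F'/F`, Galois over
`F`, with `F'` a CM field, such that `E ×_F F'` is Tate-automorphic* (`IsTateAutomorphic`), taken
as the explicit hypothesis `hACC` (it was the named fact `exists_isCMField_isTateAutomorphic` of
`Sweep1PotentialModularity` until the review of 2026-08-15 merged that decomposition child back
into this obligation, D-0026; the theorem keeps its name) — implies the named fact
`Literature.NumberTheory.Automorphic.exists_isCMField_isModular` of `Sweep1` (an elliptic curve without geometric CM over a
CM field becomes modular over a finite CM extension):
`exists_isCMField_isModular_of_weilPairing_of_finiteField` with the Weil pairing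
(`exists_weilPairing_holds`) and Thm. V.2.3.1 (`trace_galoisRepTate_frobenius_holds`) proved.  The
whole elliptic-curve side of the decomposition (Euler factors of `V_ℓ E` at the good places:
Néron–Ogg–Shafarevich in the easy direction, the reduction isomorphism `T_ℓ E ≅ T_ℓ Ẽ_v`,
`det ρ = χ_ℓ`, the Weil pairing, Hasse's `tr φ_ℓ = q + 1 - #Ẽ(k)`) is a theorem of the tree; what
remains assumed is exactly the 2023 theorem.  (Silverman's own route to V.2.3.1 through
Cor. III.6.3 and Prop. III.8.6 is also available: `degHom_isQuadraticForm_holds`,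
`Isogeny.det_tateModule_map_eq_deg_holds` of `IsogenyDegreeQuadraticFormProofs`, to be fed to
`exists_isCMField_isModular_of_isQuadraticForm` of Part 2.)
[cite: AllenCalegariCaraianiGeeEtAl2023, Thm. 1.0.1 (non-CM case), via Cor. 7.1.12 and §7.1] -/
theorem exists_isCMField_isModular_of_exists_isCMField_isTateAutomorphic
    (hACC : ∀ {F : Type} [Field F] [NumberField F] [NumberField.IsCMField F]
      (W : WeierstrassCurve F) [W.IsElliptic] (_hW : ¬ W.HasCM),
      ∃ (F' : Type) (_ : Field F') (_ : NumberField F') (_ : Algebra F F'),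
        NumberField.IsCMField F' ∧ IsGalois F F' ∧ (W.baseChange F').IsTateAutomorphic) :
    exists_isCMField_isModular :=
  exists_isCMField_isModular_of_weilPairing_of_finiteField 2 hACC
    (fun W _ ↦ W.exists_weilPairing_holds _) fun C ↦ C.trace_galoisRepTate_frobenius_holds 2

end Literature.NumberTheory.Automorphic
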